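import Summits.FinalStateConjecture.FinalStateConjecture.Theses.BondiDrainDispersal
import Literature.Geometry.Lorentzian.EventHorizon
import Literature.Geometry.Lorentzian.IdealPoints
import HarnessLib

/-!
# Crux `HorizonlessMustDrain` (stmt-FinalStateConjecture-9976) — "visible incompleteness is naked" closes C1

Line `registered` of the crux cuts at future causal geodesic completeness; its censorship stub C1
(`stub_incompletenessHidden_of_scriComplete`: complete `𝓘⁺` in Christodoulou's sojourn form hides every
future-incomplete causal geodesic behind the intrinsic event horizon) is not provable from the tree today (no
MGHD future-boundary theory).  This file certifies the sharpest sufficient fact found by lead c4's censorship tier: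

(★) **visible incompleteness is naked** — in a maximal vacuum Cauchy development of an admissible datum, a
future-incomplete future-directed causal maximal geodesic `γ` ALL of whose events are visible from infinity in the
complete-ray sense (`DataEmbedding.IsVisibleEvent`: in `I⁻` of the nonnegative half of a future-complete normalised
null ray from the data) is visible from infinity in the sojourn sense (`LorentzianMetric.IsVisibleFromInfinity`,
IdealPoints.lean: for every compact `B₀` a bound `s` such that from outside every compact `B₁` some future-INCOMPLETE
normalised ray with sojourn `< s` in `J⁺(ι B₀)` has `γ` in its chronological past).

`stub_hiddenOfNaked : (★) → C1` is then six lines: a totally visible incomplete `γ` would be visible from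
infinity, which contradicts complete `𝓘⁺` by the proved `IsVisibleFromInfinity.not_hasCompleteFutureNullInfinity`.
(★) is stated WITHOUT the complete-`𝓘⁺` hypothesis (with it, it is C1 itself); it is the sojourn-form reading of
"weak cosmic censorship ⇒ future asymptotic predictability" (Hawking–Ellis 1973, §9.2, pp. 310–312; Christodoulou,
CQG 16 (1999) A23, pp. A26–A27; Dafermos, CQG 22 (2005) 2221, §1) and the companion of route CurvatureOrSymmetry's
support item `VisibleIncompleteRay` (incomplete `𝓘⁺` ⇒ a visible incomplete null ray).  It is NOT proved here and is
not claimed as a literature fact: it is unprinted for the sojourn form.  Helper file for the crux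
(`--supports stmt-FinalStateConjecture-9976`); no definition, no named fact, no route item proved.

## References
* S. W. Hawking, G. F. R. Ellis, *The large scale structure of space-time*, CUP 1973, §9.2. Key `HawkingEllis1973CUP`.
* D. Christodoulou, *On the global initial value problem and the issue of singularities*, CQG 16 (1999) A23–A35,
  pp. A26–A27. Key `Christodoulou1999`.
* I. Rodnianski, Y. Shlapentokh-Rothman, *Naked singularities for the Einstein vacuum equations: the exterior
  solution*, Ann. of Math. 198 (2023), Def. 1.1. Key `RodnianskiShlapentokhRothman2023`.
-/

set_option linter.dupNamespace false

noncomputable section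

open Set Literature.Geometry.Lorentzian
open scoped Manifold ContDiff

namespace Summit.FinalStateConjecture.FinalStateConjecture.Theorems.BondiDrainDispersalHorizonlessMustDrain

/-- **Registered glue stub `stub_hiddenOfNaked` — (★) "visible incompleteness is naked" ⇒ C1 "complete `𝓘⁺` hides
every incompleteness".**  If, in every MGHD of an admissible datum, every future-incomplete future-directed causal
maximal geodesic all of whose events are visible (complete-ray sense) is visible from infinity in the sojourn sense,
then in every such MGHD with complete future null infinity (sojourn form) every future-incomplete future-directed
causal maximal geodesic has an event which is NOT visible: otherwise `γ '' dom` would be visible from infinity, and a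
set visible from infinity makes `𝓘⁺` incomplete (`IsVisibleFromInfinity.not_hasCompleteFutureNullInfinity`).
Hawking–Ellis 1973, §9.2; Christodoulou 1999, pp. A26–A27. [cite: HawkingEllis1973CUP, §9.2 (pp. 310–312)] -/
theorem stub_hiddenOfNaked : open scoped Manifold in (∀ (X : Type) [TopologicalSpace X] [ChartedSpace Literature.Geometry.Lorentzian.E3 X] [IsManifold (𝓡 3) ((⊤ : ℕ∞) : WithTop ℕ∞) X] [T2Space X] [SecondCountableTopology X] [ConnectedSpace X], ∀ D ∈ Literature.Geometry.Lorentzian.admissibleVacuumData X, ∀ 𝒟 : Literature.Geometry.Lorentzian.VacuumCauchyDevelopment D, 𝒟.IsMaximal → ∀ [𝒟.metric.HasLeviCivita], ∀ (γ : ℝ → 𝒟.carrier) (dom : Set ℝ), Literature.Geometry.Lorentzian.IsMaximalGeodesicOn 𝒟.metric.leviCivita γ dom → dom.Nonempty → BddAbove dom → (∀ t ∈ dom, 𝒟.metric.IsCausal (Literature.Geometry.Lorentzian.velocity (𝓡 4) γ t) ∧ 𝒟.timeOrientation.IsFutureDirected (Literature.Geometry.Lorentzian.velocity (𝓡 4)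 γ t)) → (∀ t ∈ dom, 𝒟.toDataEmbedding.IsVisibleEvent (γ t)) → 𝒟.metric.IsVisibleFromInfinity 𝒟.timeOrientation 𝒟.embed 𝒟.normal (γ '' dom)) → (∀ (X : Type) [TopologicalSpace X] [ChartedSpace Literature.Geometry.Lorentzian.E3 X] [IsManifold (𝓡 3) ((⊤ : ℕ∞) : WithTop ℕ∞) X] [T2Space X] [SecondCountableTopology X] [ConnectedSpace X], ∀ D ∈ Literature.Geometry.Lorentzian.admissibleVacuumData X, ∀ 𝒟 : Literature.Geometry.Lorentzian.VacuumCauchyDevelopment D, 𝒟.IsMaximal → Summit.FinalStateConjecture.HasCompleteNullInfinity 𝒟.toCauchyDevelopment → ∀ [𝒟.metric.HasLeviCivita], ∀ (γ : ℝ → 𝒟.carrier) (dom : Set ℝ), Literature.Geometry.Lorentzian.IsMaximalGeodesicOn 𝒟.metric.leviCivita γ dom → dom.Nonempty → BddAbove dom → (∀ t ∈ dom, 𝒟.metric.IsCausal (Literature.Geometry.Lorentzian.velocity (𝓡 4) γ t) ∧ 𝒟.timeOrientation.IsFutureDirected (Literature.Geometry.Lorentzian.velocity (𝓡 4) γ t))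 → ∃ t ∈ dom, ¬ 𝒟.toDataEmbedding.IsVisibleEvent (γ t)) := by
  intro h X _ _ _ _ _ _ D hD 𝒟 hmax hscri _ γ dom hγ hne hbdd hvel
  by_contra hall
  push Not at hall
  -- the sojourn-form completeness of `𝓘⁺`, at the Levi-Civita instance in context
  have hscri' : 𝒟.metric.HasCompleteFutureNullInfinity 𝒟.timeOrientation 𝒟.embed 𝒟.normal := hscri
  -- a totally visible incomplete `γ` would be visible from infinity, making `𝓘⁺` incomplete
  exact (h X D hD 𝒟 hmax γ dom hγ hne hbdd hvel hall).not_hasCompleteFutureNullInfinity hscri'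

end Summit.FinalStateConjecture.FinalStateConjecture.Theorems.BondiDrainDispersalHorizonlessMustDrain

end
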